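import Literature.MathematicalPhysics.QuantumLattice.YangMillsHeatFlowGradientBochner
import Literature.MathematicalPhysics.QuantumLattice.YangMillsHeatFlowEpsilonRegularity
import HarnessLib

/-!
# Evolution of `∇_A D^*F` under the Yang–Mills heat flow and the Bochner inequality for `|∇D^*F|²`

QuantumLattice support file (everything proved; no definitions, no named facts) on the proof
path of `Literature.MathematicalPhysics.QuantumLattice.Waldron2019_yangMillsFlow_flatTorus`
(A. Waldron, Invent. math. 217 (2019)), §3: the `k = 1` case of the `D^*F` estimate in the
`ε`-regularity Proposition 3.1(b) (after [instantons] Lemma 3.5 / Lemma 3.1). Flat space, frame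
form; `𝒟_v = div F(v) = ∑ᵢ D_{bᵢ}F(bᵢ, v)` (`= −D^*F`).

* `hasDerivAt_covDeriv_divCurvature_of_flow` — **evolution of `∇D^*F`**:
  `∂ₜ(D_w𝒟_v) = ∑ᵢ DᵢDᵢ(D_w𝒟_v) + 2∑ᵢ([F(w,bᵢ), Dᵢ𝒟_v] + [D_wF(v,bᵢ), 𝒟_{bᵢ}] + [F(v,bᵢ), D_w𝒟_{bᵢ}])`
  (as for `∇F`, the terms `[DᵢF(w,bᵢ), 𝒟_v]` and `[Ȧ_w, 𝒟_v]` cancel);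
* `deriv_divGradDensity_sub_laplacian_le` — **Bochner inequality** for
  `H = ∑_{ac}‖D_{b_a}𝒟_{b_c}‖²`: for every `θ > 0`,
  `∂ₜH − ∑ₗ∂ₗ∂ₗH ≤ −2∑‖DₗD_a𝒟_c‖² + (16√2 (card ι) √e + 4 (card ι) θ) H + (4/θ) N u`,
  `N = ∑‖DᵢF_{jk}‖²`, `u = ∑‖𝒟ⱼ‖²` — linear in `H` with a lower-order source once `|F|` is bounded.

References: A. Waldron, Invent. math. 217 (2019), Prop. 3.1(b) [Waldron2019]; A. Waldron,
Calc. Var. PDE 55 (2016), Lemma 3.5, Lemma 3.1 [Waldron2016].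
-/

noncomputable section

open scoped ContDiff Topology RealInnerProductSpace Matrix
open Set Filter

namespace Literature.MathematicalPhysics.QuantumLattice

/-! ### The evolution of `∇D^*F` under the flow -/

section DivGradEvolution

variable {E : Type*} [NormedAddCommGroup E] [InnerProductSpace ℝ E] [FiniteDimensional ℝ E]
variable {𝔸 : Type*} [NormedRing 𝔸] [NormedAlgebra ℝ 𝔸]
variable {ι : Type*} [Fintype ι]

/-- Finite differentiability orders are below `∞`. [folklore] -/
private theorem natCast_le_infty₁₀ (n : ℕ) : (n : WithTop ℕ∞) ≤ (⊤ : ℕ∞) := by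
  exact_mod_cast le_top

omit [Fintype ι] in
/-- **Joint smoothness of `(t, y) ↦ div F(t, y)(v)`** along a jointly smooth family on an open
time set (general normed-algebra coefficients; cf. `contDiffOn_divCurvature_joint`). [folklore] -/
theorem contDiffOn_divCurvature_joint' {A : ℝ → Connection E 𝔸} {𝒯 : Set ℝ}
    (h𝒯 : IsOpen 𝒯) (hA : ContDiffOn ℝ ∞ (fun p : ℝ × E => A p.1 p.2) (𝒯 ×ˢ (univ : Set E)))
    (v : E) :
    ContDiffOn ℝ ∞ (fun p : ℝ × E => divCurvature (A p.1) p.2 v) (𝒯 ×ˢ (univ : Set E)) := by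
  have hU : IsOpen (𝒯 ×ˢ (univ : Set E)) := h𝒯.prod isOpen_univ
  have hΦ : ∀ i, ContDiffOn ℝ ∞
      (fun p : ℝ × E => curvature (A p.1) p.2 (stdOrthonormalBasis ℝ E i) v)
      (𝒯 ×ˢ (univ : Set E)) := fun i =>
    contDiffOn_curvature_joint hU hA (m := ∞) (by norm_cast) (stdOrthonormalBasis ℝ E i) v
  have hΦ' : ∀ i, ContDiffOn ℝ ∞ (fun p : ℝ × E =>
      fderiv ℝ (fun p : ℝ × E => curvature (A p.1) p.2 (stdOrthonormalBasis ℝ E i) v) p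
        ((0 : ℝ), stdOrthonormalBasis ℝ E i)) (𝒯 ×ˢ (univ : Set E)) := fun i =>
    ((hΦ i).fderiv_of_isOpen hU (m := ∞) (by norm_cast)).clm_apply contDiffOn_const
  have hAi : ∀ i, ContDiffOn ℝ ∞ (fun p : ℝ × E => A p.1 p.2 (stdOrthonormalBasis ℝ E i))
      (𝒯 ×ˢ (univ : Set E)) := fun i => hA.clm_apply contDiffOn_const
  have hbr : ∀ i, ContDiffOn ℝ ∞ (fun p : ℝ × E =>
      ⁅A p.1 p.2 (stdOrthonormalBasis ℝ E i),
        curvature (A p.1) p.2 (stdOrthonormalBasis ℝ E i) v⁆) (𝒯 ×ˢ (univ : Set E)) := by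
    intro i
    have h := ((hAi i).mul (hΦ i)).sub ((hΦ i).mul (hAi i))
    simp only [Ring.lie_def]
    exact h
  have hsum : ContDiffOn ℝ ∞ (fun p : ℝ × E => ∑ i,
      (fderiv ℝ (fun p : ℝ × E => curvature (A p.1) p.2 (stdOrthonormalBasis ℝ E i) v) p
        ((0 : ℝ), stdOrthonormalBasis ℝ E i) +
      ⁅A p.1 p.2 (stdOrthonormalBasis ℝ E i),
        curvature (A p.1) p.2 (stdOrthonormalBasis ℝ E i) v⁆)) (𝒯 ×ˢ (univ : Set E)) :=
    ContDiffOn.sum fun i _ => (hΦ' i).add (hbr i)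
  refine hsum.congr fun p hp => ?_
  obtain ⟨t, y⟩ := p
  change divCurvature (A t) y v = _
  unfold divCurvature covDeriv
  refine Finset.sum_congr rfl fun i _ => ?_
  rw [fderiv_spaceSlice_apply hU (hΦ i) (by simp) hp (stdOrthonormalBasis ℝ E i)]

/-- **Evolution of the covariant derivative of `D^*F` under the Yang–Mills heat flow** (flat
space). Let `A` be jointly smooth on `𝒯 × E` (`𝒯` open) and solve `∂ₜA = div_A F_A` on `𝒯`;
write `𝒟_v = div F(v)`. Then for `t ∈ 𝒯`, every `x`, vectors `v w` and any orthonormal frame `b`,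
`∂ₜ (D_w𝒟_v) = ∑ᵢ DᵢDᵢ(D_w𝒟_v)
  + 2 ∑ᵢ ([F(w,bᵢ), Dᵢ𝒟_v] + [D_wF(v,bᵢ), 𝒟_{bᵢ}] + [F(v,bᵢ), D_w𝒟_{bᵢ}])`
(differentiate `D_w𝒟_v` in time using `∂ₜD = D∂ₜ + [Ȧ, ·]` and the evolution of `𝒟`,
`hasDerivAt_divCurvature_of_flow`, commute `D_w` through `∑DᵢDᵢ`; `[DᵢF(w,bᵢ), 𝒟_v] + [Ȧ_w, 𝒟_v]`
cancels since `Ȧ_w = 𝒟_w = −∑ᵢDᵢF(w,bᵢ)`). [cite: Waldron2016, Lemma 3.5 / Lemma 3.1 (k = 1);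
Waldron2019, Prop. 3.1(b)] -/
theorem hasDerivAt_covDeriv_divCurvature_of_flow (b : OrthonormalBasis ι ℝ E)
    {A : ℝ → Connection E 𝔸} {𝒯 : Set ℝ} (h𝒯 : IsOpen 𝒯)
    (hA : ContDiffOn ℝ ∞ (fun p : ℝ × E => A p.1 p.2) (𝒯 ×ˢ (univ : Set E)))
    (hpde : ∀ ⦃s : ℝ⦄, s ∈ 𝒯 → ∀ y w, deriv (fun s' => A s' y w) s = divCurvature (A s) y w)
    {t : ℝ} (ht : t ∈ 𝒯) (x v w : E) :
    HasDerivAt (fun s => covDeriv (A s) (fun z => divCurvature (A s) z v) x w)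
      (∑ i, covDeriv (A t) (fun y => covDeriv (A t)
          (fun z => covDeriv (A t) (fun z' => divCurvature (A t) z' v) z w) y (b i)) x (b i) +
        (2 : ℝ) • ∑ i, (⁅curvature (A t) x w (b i),
            covDeriv (A t) (fun z => divCurvature (A t) z v) x (b i)⁆ +
          ⁅covDeriv (A t) (fun z => curvature (A t) z v (b i)) x w, divCurvature (A t) x (b i)⁆ +
          ⁅curvature (A t) x v (b i), covDeriv (A t) (fun z => divCurvature (A t) z (b i)) x w⁆)) t := by
  have hU : IsOpen (𝒯 ×ˢ (univ : Set E)) := h𝒯.prod isOpen_univ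
  have hp : ∀ y, (t, y) ∈ 𝒯 ×ˢ (univ : Set E) := fun y => ⟨ht, mem_univ y⟩
  have hsm : ContDiff ℝ ∞ (A t) := contDiff_slice_of_contDiffOn_prod hA ht
  have hA1 : ContDiff ℝ 1 (A t) := hsm.of_le (natCast_le_infty₁₀ 1)
  have hA2 : ContDiff ℝ 2 (A t) := hsm.of_le (natCast_le_infty₁₀ 2)
  have hA21 : ContDiff ℝ (2 + 1) (A t) := by
    rw [show (2 : WithTop ℕ∞) + 1 = 3 by norm_num]; exact hsm.of_le (natCast_le_infty₁₀ 3)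
  have hA12 : ContDiff ℝ (1 + 2) (A t) := by
    rw [show (1 : WithTop ℕ∞) + 2 = 3 by norm_num]; exact hsm.of_le (natCast_le_infty₁₀ 3)
  have hA32 : ContDiff ℝ (3 + 2) (A t) := by
    rw [show (3 : WithTop ℕ∞) + 2 = 5 by norm_num]; exact hsm.of_le (natCast_le_infty₁₀ 5)
  have hA22 : ContDiff ℝ (2 + 2) (A t) := by
    rw [show (2 : WithTop ℕ∞) + 2 = 4 by norm_num]; exact hsm.of_le (natCast_le_infty₁₀ 4)
  -- regularity of the players
  have hF2 : ∀ a c, ContDiff ℝ 2 (fun z => curvature (A t) z a c) := fun a c =>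
    contDiff_curvature_apply hA21 a c
  have hFd : ∀ a c y, DifferentiableAt ℝ (fun z => curvature (A t) z a c) y := fun a c y =>
    ((hF2 a c).differentiable two_ne_zero) y
  have hD3 : ∀ a, ContDiff ℝ 3 (fun z => divCurvature (A t) z a) := fun a =>
    contDiff_divCurvature_apply hA32 a
  have hD2 : ∀ a, ContDiff ℝ 2 (fun z => divCurvature (A t) z a) := fun a =>
    contDiff_divCurvature_apply hA22 a
  have hDd : ∀ a y, DifferentiableAt ℝ (fun z => divCurvature (A t) z a) y := fun a y =>
    ((hD2 a).differentiable two_ne_zero) y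
  have hDD2 : ∀ a d, ContDiff ℝ 2 (fun z => covDeriv (A t) (fun z' => divCurvature (A t) z' a) z d) :=
    fun a d => by
    have h21 : ContDiff ℝ (2 + 1) fun z' => divCurvature (A t) z' a := by
      rw [show (2 : WithTop ℕ∞) + 1 = 3 by norm_num]; exact hD3 a
    exact contDiff_covDeriv_apply hA2 h21 d
  have hDDd : ∀ a d y, DifferentiableAt ℝ
      (fun z => covDeriv (A t) (fun z' => divCurvature (A t) z' a) z d) y := fun a d y =>
    ((hDD2 a d).differentiable two_ne_zero) y
  have hDDDd : ∀ a d d' y, DifferentiableAt ℝ (fun y' => covDeriv (A t)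
      (fun z => covDeriv (A t) (fun z' => divCurvature (A t) z' a) z d) y' d') y := fun a d d' y =>
    differentiableAt_covDeriv_apply hA1 (hDD2 a d) d' y
  -- ### the time derivative `Ȧ(t) = div F`
  have hdiv : ∀ y a, fderiv ℝ (fun p : ℝ × E => A p.1 p.2) (t, y) ((1 : ℝ), (0 : E)) a =
      ∑ i, covDeriv (A t) (fun z => curvature (A t) z (b i) a) y (b i) := by
    intro y a
    have h1 : divCurvature (A t) y a =
        fderiv ℝ (fun p : ℝ × E => A p.1 p.2) (t, y) ((1 : ℝ), (0 : E)) a := by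
      rw [← hpde ht y a]
      exact (hasDerivAt_slice_apply hU hA (by simp) (hp y) a).deriv
    rw [← h1]
    exact divCurvature_eq_sum_orthonormalBasis b (A t) hA2 y a
  -- ### Step 1: `∂ₜ(D_w𝒟) = D_w(∂ₜ𝒟) + [Ȧ_w, 𝒟]`
  have hΦ : ContDiffOn ℝ ∞ (fun p : ℝ × E => divCurvature (A p.1) p.2 v) (𝒯 ×ˢ (univ : Set E)) :=
    contDiffOn_divCurvature_joint' h𝒯 hA v
  have h1 := hasDerivAt_covDeriv_timeSlice hU hA hΦ (natCast_le_infty₁₀ 2) (hp x) w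
  -- ### Step 2: `∂ₜ𝒟_v(t, y) = ∑ᵢ DᵢDᵢ𝒟_v(y) + 2∑ᵢ[F(v,bᵢ), 𝒟_{bᵢ}]` as a function of `y`
  have hDt : (fun y => fderiv ℝ (fun p : ℝ × E => divCurvature (A p.1) p.2 v) (t, y)
      ((1 : ℝ), (0 : E))) = fun y =>
      ∑ i, covDeriv (A t) (fun y' => covDeriv (A t) (fun z => divCurvature (A t) z v) y' (b i)) y
        (b i) + (2 : ℝ) • ∑ i, ⁅curvature (A t) y v (b i), divCurvature (A t) y (b i)⁆ := by
    funext y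
    exact (hasDerivAt_timeSlice hU hΦ (by simp) (hp y)).unique
      (hasDerivAt_divCurvature_of_flow b h𝒯 hA hpde ht y v)
  rw [hDt] at h1
  refine h1.congr_deriv ?_
  -- ### Step 3: algebra
  have hlie_d : ∀ i y, DifferentiableAt ℝ
      (fun y => ⁅curvature (A t) y v (b i), divCurvature (A t) y (b i)⁆) y := by
    intro i y
    have heq : (fun y => ⁅curvature (A t) y v (b i), divCurvature (A t) y (b i)⁆) =
        fun y => curvature (A t) y v (b i) * divCurvature (A t) y (b i) -
          divCurvature (A t) y (b i) * curvature (A t) y v (b i) := funext fun y => Ring.lie_def _ _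
    rw [heq]
    exact ((hFd v (b i) y).mul (hDd (b i) y)).sub ((hDd (b i) y).mul (hFd v (b i) y))
  have hsum_d : ∀ y, DifferentiableAt ℝ (fun y => ∑ i, covDeriv (A t)
      (fun y' => covDeriv (A t) (fun z => divCurvature (A t) z v) y' (b i)) y (b i)) y := fun y =>
    DifferentiableAt.fun_sum fun i _ => hDDDd v (b i) (b i) y
  have hsmul_d : ∀ y, DifferentiableAt ℝ
      (fun y => (2 : ℝ) • ∑ i, ⁅curvature (A t) y v (b i), divCurvature (A t) y (b i)⁆) y :=
    fun y => (differentiableAt_const (2 : ℝ)).smul (DifferentiableAt.fun_sum fun i _ => hlie_d i y)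
  rw [covDeriv_fun_add (A t) (hsum_d x) (hsmul_d x) w,
    covDeriv_sum_covDeriv_covDeriv_eq b (A t) hA2 (hD3 v) x w,
    covDeriv_fun_smul (A t) 2 (DifferentiableAt.fun_sum fun i _ => hlie_d i x) w,
    covDeriv_fun_sum Finset.univ (A t) (fun i _ => hlie_d i x) w]
  have hL : ∑ i, covDeriv (A t) (fun y => ⁅curvature (A t) y v (b i), divCurvature (A t) y (b i)⁆) x w =
      ∑ i, (⁅covDeriv (A t) (fun z => curvature (A t) z v (b i)) x w, divCurvature (A t) x (b i)⁆ +
        ⁅curvature (A t) x v (b i), covDeriv (A t) (fun z => divCurvature (A t) z (b i)) x w⁆) :=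
    Finset.sum_congr rfl fun i _ => covDeriv_lie_apply (A t) (hFd v (b i) x) (hDd (b i) x) w
  -- the cancellation `∑ᵢ [DᵢF(w,bᵢ), 𝒟] + [Ȧ_w, 𝒟] = 0`
  have hcancel : ∑ i, ⁅covDeriv (A t) (fun z => curvature (A t) z w (b i)) x (b i),
      divCurvature (A t) x v⁆ +
      ⁅fderiv ℝ (fun p : ℝ × E => A p.1 p.2) (t, x) ((1 : ℝ), (0 : E)) w, divCurvature (A t) x v⁆ =
      0 := by
    rw [hdiv x w]
    simp only [Ring.lie_def, Finset.sum_mul, Finset.mul_sum, ← Finset.sum_sub_distrib,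
      ← Finset.sum_add_distrib]
    refine Finset.sum_eq_zero fun i _ => ?_
    rw [show (fun z => curvature (A t) z (b i) w) = fun z => -curvature (A t) z w (b i) from
      funext fun z => curvature_antisymm (A t) z (b i) w, covDeriv_fun_neg]
    noncomm_ring
  rw [hL, eq_neg_of_add_eq_zero_right hcancel]
  simp only [smul_add, Finset.smul_sum, Finset.sum_add_distrib]
  abel

end DivGradEvolution

/-! ### The Bochner inequality for `|∇D^*F|²` -/

section DivGradBochner

open scoped Matrix.Norms.Frobenius

attribute [local instance] frobeniusInnerProductSpace

variable {m : Type*} [Fintype m] [DecidableEq m]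
variable {E : Type*} [NormedAddCommGroup E] [InnerProductSpace ℝ E] [FiniteDimensional ℝ E]
variable {ι : Type*} [Fintype ι] [LinearOrder ι]

omit [LinearOrder ι] in
/-- Moving the innermost of three sums outermost. [folklore] -/
private theorem sum3_comm_last {X : Type*} [AddCommMonoid X] (f : ι → ι → ι → X) :
    ∑ a, ∑ c, ∑ l, f a c l = ∑ l, ∑ a, ∑ c, f a c l :=
  calc ∑ a, ∑ c, ∑ l, f a c l = ∑ a, ∑ l, ∑ c, f a c l :=
        Finset.sum_congr rfl fun a _ => Finset.sum_comm (f := fun c l => f a c l)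
    _ = ∑ l, ∑ a, ∑ c, f a c l := Finset.sum_comm (f := fun a l => ∑ c, f a c l)

omit [LinearOrder ι] in
/-- `∑ᵢⱼ aᵢ aⱼ ≤ card · ∑ aᵢ²`. [folklore] -/
private theorem sum_sum_mul_le_card_mul_sum_sq' (a : ι → ℝ) :
    ∑ i, ∑ l, a i * a l ≤ Fintype.card ι * ∑ i, a i ^ 2 := by
  rw [← Finset.sum_mul_sum, ← sq]
  have h := sq_sum_le_card_mul_sum_sq (s := Finset.univ) (f := a)
  simpa using h

/-- Weighted arithmetic–geometric mean: `2xy ≤ θx² + y²/θ` for `θ > 0`. [folklore] -/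
private theorem two_mul_le_weighted {θ : ℝ} (hθ : 0 < θ) (x y : ℝ) :
    2 * x * y ≤ θ * x ^ 2 + y ^ 2 / θ := by
  have h : 0 ≤ (θ * x - y) ^ 2 / θ := div_nonneg (sq_nonneg _) hθ.le
  have e : (θ * x - y) ^ 2 / θ = θ * x ^ 2 + y ^ 2 / θ - 2 * x * y := by
    field_simp; ring
  linarith [h, e]

/-- **The Bochner inequality for `|∇D^*F|²` along the Yang–Mills heat flow** (flat space; the
`k = 1` case of the `D^*F` estimate). For a jointly smooth `𝔲(m)`-valued solution on an open time
set `𝒯 ∋ t`, an orthonormal frame `b`, and every `θ > 0`, with `𝒟_v = div F(v)`,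
`H = ∑_{ac}‖D_{b_a}𝒟_{b_c}‖²`, `N = ∑_{ijk}‖DᵢF_{jk}‖²`, `u = ∑ⱼ‖𝒟ⱼ‖²`, `e = ymDensityOfBasis b`:
`∂ₜH − ∑ₗ∂ₗ∂ₗH ≤ −2∑‖DₗD_a𝒟_c‖² + (16√2 (card ι)√e + 4(card ι)θ) H + (4/θ) N u`
(the cubic terms `⟨D𝒟, [F, D𝒟]⟩` are linear in `H` with coefficient `≲ √e`; the mixed term
`⟨D𝒟, [DF, 𝒟]⟩` is split by the weighted mean inequality).
[cite: Waldron2016, Lemma 3.5 / Lemma 3.1 (k = 1); Waldron2019, Prop. 3.1(b)] -/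
theorem deriv_divGradDensity_sub_laplacian_le (b : OrthonormalBasis ι ℝ E)
    {A : ℝ → Connection E (Matrix m m ℂ)} {𝒯 : Set ℝ} (h𝒯 : IsOpen 𝒯)
    (hA : ContDiffOn ℝ ∞ (fun p : ℝ × E => A p.1 p.2) (𝒯 ×ˢ (univ : Set E)))
    (hval : ∀ ⦃s : ℝ⦄, s ∈ 𝒯 → (A s).IsValuedIn (skewAdjoint.submodule ℝ (Matrix m m ℂ)))
    (hpde : ∀ ⦃s : ℝ⦄, s ∈ 𝒯 → ∀ y w, deriv (fun s' => A s' y w) s = divCurvature (A s) y w)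
    {t : ℝ} (ht : t ∈ 𝒯) (x : E) {θ : ℝ} (hθ : 0 < θ) :
    deriv (fun s => ∑ a, ∑ c,
        ‖covDeriv (A s) (fun z => divCurvature (A s) z (b c)) x (b a)‖ ^ 2) t -
        ∑ l, fderiv ℝ (fun y => fderiv ℝ (fun z => ∑ a, ∑ c,
          ‖covDeriv (A t) (fun z' => divCurvature (A t) z' (b c)) z (b a)‖ ^ 2) y (b l)) x (b l) ≤
      -(2 * ∑ l, ∑ a, ∑ c, ‖covDeriv (A t) (fun y => covDeriv (A t)
          (fun z => divCurvature (A t) z (b c)) y (b a)) x (b l)‖ ^ 2) +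
        (16 * Real.sqrt 2 * (Fintype.card ι : ℝ) * Real.sqrt (ymDensityOfBasis b (A t) x) +
            4 * (Fintype.card ι : ℝ) * θ) *
          ∑ a, ∑ c, ‖covDeriv (A t) (fun z => divCurvature (A t) z (b c)) x (b a)‖ ^ 2 +
        4 / θ * ((∑ i, ∑ j, ∑ k,
            ‖covDeriv (A t) (fun z => curvature (A t) z (b j) (b k)) x (b i)‖ ^ 2) *
          ∑ j, ‖divCurvature (A t) x (b j)‖ ^ 2) := by
  have hsm : ContDiff ℝ ∞ (A t) := contDiff_slice_of_contDiffOn_prod hA ht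
  have hA1 : ContDiff ℝ 1 (A t) := hsm.of_le (natCast_le_infty₁₀ 1)
  have hA2 : ContDiff ℝ 2 (A t) := hsm.of_le (natCast_le_infty₁₀ 2)
  have hA32 : ContDiff ℝ (3 + 2) (A t) := by
    rw [show (3 : WithTop ℕ∞) + 2 = 5 by norm_num]; exact hsm.of_le (natCast_le_infty₁₀ 5)
  -- ### notation
  set Df : ι → Matrix m m ℂ := fun j => divCurvature (A t) x (b j) with hDf
  set Gf : ι → ι → E → Matrix m m ℂ := fun a c y =>
    covDeriv (A t) (fun z => divCurvature (A t) z (b c)) y (b a) with hGf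
  set G : ι → ι → Matrix m m ℂ := fun a c => Gf a c x with hG
  set DF : ι → ι → ι → Matrix m m ℂ := fun a c i =>
    covDeriv (A t) (fun z => curvature (A t) z (b c) (b i)) x (b a) with hDF
  have hGf2 : ∀ a c, ContDiff ℝ 2 (Gf a c) := fun a c => by
    have h21 : ContDiff ℝ (2 + 1) fun z' => divCurvature (A t) z' (b c) := by
      rw [show (2 : WithTop ℕ∞) + 1 = 3 by norm_num]; exact contDiff_divCurvature_apply hA32 (b c)
    exact contDiff_covDeriv_apply hA2 h21 (b a)
  -- ### the time derivative of `H`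
  set L : ι → ι → Matrix m m ℂ := fun a c =>
    ∑ l, covDeriv (A t) (fun y => covDeriv (A t) (Gf a c) y (b l)) x (b l) with hL
  set Q : ι → ι → Matrix m m ℂ := fun a c =>
    ∑ i, (⁅curvature (A t) x (b a) (b i), Gf i c x⁆ + ⁅DF a c i, Df i⁆ +
      ⁅curvature (A t) x (b c) (b i), Gf a i x⁆) with hQ
  have hac : ∀ a c, HasDerivAt
      (fun s => ‖covDeriv (A s) (fun z => divCurvature (A s) z (b c)) x (b a)‖ ^ 2)
      (2 * ⟪G a c, L a c + (2 : ℝ) • Q a c⟫) t := fun a c =>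
    (hasDerivAt_covDeriv_divCurvature_of_flow b h𝒯 hA hpde ht x (b c) (b a)).norm_sq
  have hH : HasDerivAt (fun s => ∑ a, ∑ c,
      ‖covDeriv (A s) (fun z => divCurvature (A s) z (b c)) x (b a)‖ ^ 2)
      (∑ a, ∑ c, 2 * ⟪G a c, L a c + (2 : ℝ) • Q a c⟫) t :=
    HasDerivAt.fun_sum fun a _ => HasDerivAt.fun_sum fun c _ => hac a c
  rw [hH.deriv]
  -- ### the Laplacian of `H` via the generic Leibniz computation over `κ = ι × ι`
  have hψ : ∀ p : ι × ι, ContDiff ℝ 2 (Gf p.1 p.2) := fun p => hGf2 _ _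
  have hlap := sum_fderiv_fderiv_sum_norm_sq_eq (κ := ι × ι) b hA1 (hval ht)
    (ψ := fun p => Gf p.1 p.2) hψ x
  have hfun : (fun z => ∑ p : ι × ι, ‖Gf p.1 p.2 z‖ ^ 2) = fun z => ∑ a, ∑ c,
      ‖covDeriv (A t) (fun z' => divCurvature (A t) z' (b c)) z (b a)‖ ^ 2 := by
    funext z
    simp only [Fintype.sum_prod_type, hGf]
  rw [hfun] at hlap
  rw [hlap]
  simp only [Fintype.sum_prod_type]
  -- ### bookkeeping
  have e1 : ∑ a, ∑ c, 2 * ⟪G a c, L a c + (2 : ℝ) • Q a c⟫ =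
      2 * (∑ a, ∑ c, ⟪G a c, L a c⟫) + 4 * ∑ a, ∑ c, ⟪G a c, Q a c⟫ := by
    simp only [inner_add_right, inner_smul_right, mul_add, Finset.sum_add_distrib, ← Finset.mul_sum]
    ring
  have e2 : ∑ a, ∑ c, ⟪G a c, L a c⟫ = ∑ l, ∑ a, ∑ c,
      ⟪Gf a c x, covDeriv (A t) (fun y => covDeriv (A t) (Gf a c) y (b l)) x (b l)⟫ := by
    simp only [hL, hG, inner_sum]
    exact sum3_comm_last _
  rw [e1, e2]
  -- ### the cubic and source terms
  set ee : ℝ := ymDensityOfBasis b (A t) x with hee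
  set Hs : ℝ := ∑ a, ∑ c, ‖G a c‖ ^ 2 with hHs
  set Ns : ℝ := ∑ a, ∑ c, ∑ i, ‖DF a c i‖ ^ 2 with hNs
  set us : ℝ := ∑ j, ‖Df j‖ ^ 2 with hus
  have hF : ∀ j k, ‖curvature (A t) x (b j) (b k)‖ ≤ Real.sqrt (2 * ee) := fun j k =>
    norm_curvature_apply_le_sqrt b (A t) x j k
  set c₀ : ℝ := 2 * Real.sqrt (2 * ee) with hc₀
  have hc₀0 : 0 ≤ c₀ := by positivity
  have hbr1 : ∀ (X Y : Matrix m m ℂ) (j k : ι), ⟪X, ⁅curvature (A t) x (b j) (b k), Y⁆⟫ ≤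
      c₀ * (‖X‖ * ‖Y‖) := fun X Y j k =>
    calc ⟪X, ⁅curvature (A t) x (b j) (b k), Y⁆⟫ ≤ |⟪X, ⁅curvature (A t) x (b j) (b k), Y⁆⟫| :=
          le_abs_self _
      _ ≤ 2 * ‖X‖ * ‖curvature (A t) x (b j) (b k)‖ * ‖Y‖ := abs_frobenius_inner_lie_le _ _ _
      _ ≤ 2 * ‖X‖ * Real.sqrt (2 * ee) * ‖Y‖ := by gcongr; exact hF j k
      _ = c₀ * (‖X‖ * ‖Y‖) := by rw [hc₀]; ring
  have hbr3 : ∀ (X Y Z : Matrix m m ℂ), ⟪X, ⁅Y, Z⁆⟫ ≤ θ * ‖X‖ ^ 2 + (‖Y‖ * ‖Z‖) ^ 2 / θ :=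
    fun X Y Z =>
    calc ⟪X, ⁅Y, Z⁆⟫ ≤ |⟪X, ⁅Y, Z⁆⟫| := le_abs_self _
      _ ≤ 2 * ‖X‖ * ‖Y‖ * ‖Z‖ := abs_frobenius_inner_lie_le _ _ _
      _ = 2 * ‖X‖ * (‖Y‖ * ‖Z‖) := by ring
      _ ≤ θ * ‖X‖ ^ 2 + (‖Y‖ * ‖Z‖) ^ 2 / θ := two_mul_le_weighted hθ _ _
  have hQle : ∀ a c, ⟪G a c, Q a c⟫ ≤ ∑ i, (c₀ * (‖G a c‖ * ‖G i c‖) +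
      (θ * ‖G a c‖ ^ 2 + (‖DF a c i‖ * ‖Df i‖) ^ 2 / θ) + c₀ * (‖G a c‖ * ‖G a i‖)) := by
    intro a c
    simp only [hQ, hG, inner_sum, inner_add_right]
    refine Finset.sum_le_sum fun i _ => add_le_add (add_le_add ?_ ?_) ?_
    · exact hbr1 _ _ a i
    · exact hbr3 _ _ _
    · exact hbr1 _ _ c i
  -- the four resulting sums
  have hT1 : ∑ a, ∑ c, ∑ i, ‖G a c‖ * ‖G i c‖ ≤ Fintype.card ι * Hs := by
    have hre : ∑ a, ∑ c, ∑ i, ‖G a c‖ * ‖G i c‖ = ∑ c, ∑ a, ∑ i, ‖G a c‖ * ‖G i c‖ :=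
      Finset.sum_comm (f := fun a c => ∑ i, ‖G a c‖ * ‖G i c‖)
    have hH' : Hs = ∑ c, ∑ a, ‖G a c‖ ^ 2 := Finset.sum_comm (f := fun a c => ‖G a c‖ ^ 2)
    rw [hre, hH', Finset.mul_sum]
    exact Finset.sum_le_sum fun c _ => sum_sum_mul_le_card_mul_sum_sq' fun a => ‖G a c‖
  have hT2 : ∑ a, ∑ c, ∑ i, ‖G a c‖ * ‖G a i‖ ≤ Fintype.card ι * Hs := by
    rw [hHs, Finset.mul_sum]
    exact Finset.sum_le_sum fun a _ => sum_sum_mul_le_card_mul_sum_sq' fun c => ‖G a c‖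
  have hT3 : ∑ a, ∑ c, ∑ _i : ι, θ * ‖G a c‖ ^ 2 = Fintype.card ι * θ * Hs := by
    simp only [Finset.sum_const, Finset.card_univ, nsmul_eq_mul, hHs, Finset.mul_sum]
    refine Finset.sum_congr rfl fun a _ => Finset.sum_congr rfl fun c _ => by ring
  have hDf0 : ∀ i, ‖Df i‖ ^ 2 ≤ us := fun i =>
    Finset.single_le_sum (f := fun j => ‖Df j‖ ^ 2) (fun j _ => sq_nonneg _) (Finset.mem_univ i)
  have hT4 : ∑ a, ∑ c, ∑ i, (‖DF a c i‖ * ‖Df i‖) ^ 2 / θ ≤ 1 / θ * (Ns * us) := by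
    rw [hNs, Finset.sum_mul, Finset.mul_sum]
    refine Finset.sum_le_sum fun a _ => ?_
    rw [Finset.sum_mul, Finset.mul_sum]
    refine Finset.sum_le_sum fun c _ => ?_
    rw [Finset.sum_mul, Finset.mul_sum]
    refine Finset.sum_le_sum fun i _ => ?_
    rw [mul_pow, div_eq_mul_inv, one_div]
    have h1 : ‖DF a c i‖ ^ 2 * ‖Df i‖ ^ 2 ≤ ‖DF a c i‖ ^ 2 * us :=
      mul_le_mul_of_nonneg_left (hDf0 i) (sq_nonneg _)
    calc ‖DF a c i‖ ^ 2 * ‖Df i‖ ^ 2 * θ⁻¹ ≤ ‖DF a c i‖ ^ 2 * us * θ⁻¹ :=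
          mul_le_mul_of_nonneg_right h1 (inv_nonneg.2 hθ.le)
      _ = θ⁻¹ * (‖DF a c i‖ ^ 2 * us) := by ring
  have hGQ : ∑ a, ∑ c, ⟪G a c, Q a c⟫ ≤
      c₀ * (Fintype.card ι * Hs) + (Fintype.card ι * θ * Hs + 1 / θ * (Ns * us)) +
        c₀ * (Fintype.card ι * Hs) := by
    calc ∑ a, ∑ c, ⟪G a c, Q a c⟫
        ≤ ∑ a, ∑ c, ∑ i, (c₀ * (‖G a c‖ * ‖G i c‖) +
            (θ * ‖G a c‖ ^ 2 + (‖DF a c i‖ * ‖Df i‖) ^ 2 / θ) + c₀ * (‖G a c‖ * ‖G a i‖)) :=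
          Finset.sum_le_sum fun a _ => Finset.sum_le_sum fun c _ => hQle a c
      _ = c₀ * (∑ a, ∑ c, ∑ i, ‖G a c‖ * ‖G i c‖) +
            ((∑ a, ∑ c, ∑ _i : ι, θ * ‖G a c‖ ^ 2) + ∑ a, ∑ c, ∑ i, (‖DF a c i‖ * ‖Df i‖) ^ 2 / θ) +
            c₀ * ∑ a, ∑ c, ∑ i, ‖G a c‖ * ‖G a i‖ := by
          simp only [Finset.sum_add_distrib, Finset.mul_sum]
      _ ≤ c₀ * (Fintype.card ι * Hs) + (Fintype.card ι * θ * Hs + 1 / θ * (Ns * us)) +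
            c₀ * (Fintype.card ι * Hs) := by
          rw [hT3]
          exact add_le_add (add_le_add (mul_le_mul_of_nonneg_left hT1 hc₀0)
            (add_le_add_right hT4 _)) (mul_le_mul_of_nonneg_left hT2 hc₀0)
  have hsqrt : Real.sqrt (2 * ee) = Real.sqrt 2 * Real.sqrt ee := Real.sqrt_mul (by norm_num) ee
  have hfin : 4 * ∑ a, ∑ c, ⟪G a c, Q a c⟫ ≤
      (16 * Real.sqrt 2 * (Fintype.card ι : ℝ) * Real.sqrt ee + 4 * (Fintype.card ι : ℝ) * θ) * Hs +
        4 / θ * (Ns * us) := by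
    have h := mul_le_mul_of_nonneg_left hGQ (by norm_num : (0 : ℝ) ≤ 4)
    have e : 4 * (c₀ * (Fintype.card ι * Hs) + (Fintype.card ι * θ * Hs + 1 / θ * (Ns * us)) +
        c₀ * (Fintype.card ι * Hs)) =
        (16 * Real.sqrt 2 * (Fintype.card ι : ℝ) * Real.sqrt ee + 4 * (Fintype.card ι : ℝ) * θ) * Hs +
          4 / θ * (Ns * us) := by
      rw [hc₀, hsqrt]; ring
    linarith only [h, e]
  simp only [hHs, hNs, hus, hG, hDF, hDf] at hfin
  linarith only [hfin]

end DivGradBochner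

end Literature.MathematicalPhysics.QuantumLattice
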